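import Mathlib
import Summits.PneNP.PneNP.Theorems.OverlapGapAlgebraSearchHardWindowVanishingRobustSign
import Summits.PneNP.PneNP.Theorems.OverlapGapAlgebraSearchHardWindowTruncationSurrogate
import Summits.PneNP.PneNP.Theorems.OverlapGapAlgebraSearchHardWindowRungAssembly
import Literature.Computability.Complexity.RandomKSatLowDegreeHardness

/-!
# Route OverlapGapAlgebra, crux `SearchHardWindow` (stmt-PneNP-2460): the ROBUST class rung —
# Boolean solver classes with Fourier tails `≤ τ` (any fixed `τ`) at a level `o(n / log² n)` fail

The class rung `shw_classRung` (`…RungAssembly.lean`, line Sketch / Line A) needs Fourier tails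
`≤ n⁻³` above a level `o(n)` (it is built on the saturated form of Huang–Sellke's theorem, where ONE
bad output coordinate spoils an input, so the tails are union-bounded over the `n` coordinates).
Classes whose spectral concentration comes from ONE round of random restrictions — de Morgan
formulas of sub-quadratic size via Håstad's shrinkage (`…FormulaTails.lean`) — only have tails
`O(1/t)` at level `t · s^{1/γ}`. For them this file proves the robust rung, UNCONDITIONALLY:

**Theorem (`shwF_robustClassRung`).** There is `k₀` such that for all `k ≥ k₀` and every family of
classes `𝒢 n N` of Boolean functions on `N` bits with the property
  "for every `τ > 0` there is a level `D_τ(n) = o(n / log² n)` such that eventually in `n` every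
   `g ∈ 𝒢 n N` (any `N`) has `W^{≥ D_τ(n)}[sgn ∘ g] ≤ τ`",
for every `ε > 0`, eventually in `n`: whenever `n = 2^j` and `m = ⌊5 · 2^k log k / k · n⌋`, every
family `g : Fin (2^j) → 𝒢 n (m k (j+1))` (one Boolean function per output variable, reading the
`m·k·(j+1)` instance bits under `litArrayOfBits`) outputs a satisfying assignment of the decoded
instance of `F_k(2^j, m)` for at most `ε · 2^{m k (j+1)}` inputs.

Proof. With `η₀` from `vanishingLowDegreeRobustSign` take `τ = ε η₀ / 18` and its level `D_τ`.
Truncate each `h_v = sgn ∘ g_v` below `D_τ(n)`: the surrogate `p_v = -3 T_{<D} h_v` has energy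
`≤ 9 · 2^N` (`shw_energy`) and is saturated with the sign of `g_v` outside a set of
`≤ 9 · 2^N · W^{≥D}[h_v] ≤ 9 τ 2^N` inputs (`shw_bad_card_le`), PER COORDINATE. Summing over `v` and
applying Markov over inputs, at most `9 τ n 2^N / (η₀ n) = ε/2 · 2^N` inputs have more than `η₀ n`
bad coordinates. On every other input solved by the family, the decoded instance `Φ` carries a
satisfying assignment (`σ_v = g_v(x)`) differing from the saturated sign pattern of the surrogate
(read through `bitsOfLitArray`: coordinate degree `< D_τ(n)`, energy `≤ 9 n #Inst`) on `≤ η₀ n`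
coordinates — the event bounded by `ε/2 · #Inst` by `vanishingLowDegreeRobustSign` (threshold
uniform in the map, so no transport of a fixed sequence is needed). No new definitions; axioms
standard.

References: O'Donnell 2014 §3.1 (truncation) [ODonnell2014]; Linial–Mansour–Nisan 1993
[LinialMansourNisan1993]; Bresler–Huang arXiv:2106.02129 Thm. 2.6 [BreslerHuang2022]; Huang–Sellke
arXiv:2501.06427 Cor. 3.21 [HuangSellke2025].
-/

set_option linter.dupNamespace false -- `Summit.PneNP.PneNP.…`: summit = sub-problem (D-0017)

noncomputable section

namespace Summit.PneNP.PneNP.Theorems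

open Finset Filter Asymptotics
open Literature.Computability.Complexity Literature.Computability.Complexity.LowDegree
open Literature.Probability.RandomGraphs.LowDegree (sgn walsh)
open scoped Classical

/-- Markov over the first factor for a finite relation: the points `x` with more than `a` partners
number at most `#R / a`. [folklore] -/
theorem shwF_card_filter_lt_card_le {α β : Type*} [Fintype α] [Fintype β] (R : α → β → Prop)
    [∀ x v, Decidable (R x v)] (a : ℝ) :
    a * ((univ.filter fun x : α => a < ((univ.filter fun v : β => R x v).card : ℝ)).card : ℝ) ≤
      ∑ x : α, ((univ.filter fun v : β => R x v).card : ℝ) := by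
  calc a * ((univ.filter fun x : α => a < ((univ.filter fun v : β => R x v).card : ℝ)).card : ℝ)
      = ∑ _x ∈ univ.filter (fun x : α => a < ((univ.filter fun v : β => R x v).card : ℝ)), a := by
        rw [Finset.sum_const, nsmul_eq_mul, mul_comm]
    _ ≤ ∑ x ∈ univ.filter (fun x : α => a < ((univ.filter fun v : β => R x v).card : ℝ)),
          ((univ.filter fun v : β => R x v).card : ℝ) :=
        Finset.sum_le_sum fun x hx => (Finset.mem_filter.1 hx).2.le
    _ ≤ ∑ x : α, ((univ.filter fun v : β => R x v).card : ℝ) :=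
        Finset.sum_le_sum_of_subset_of_nonneg (Finset.subset_univ _) fun _ _ _ => Nat.cast_nonneg _

/-- Exchanging the order of a double count: `∑_x #{v : R x v} = ∑_v #{x : R x v}`. [folklore] -/
theorem shwF_sum_card_filter_comm {α β : Type*} [Fintype α] [Fintype β] (R : α → β → Prop)
    [∀ x v, Decidable (R x v)] :
    ∑ x : α, ((univ.filter fun v : β => R x v).card : ℝ) =
      ∑ v : β, ((univ.filter fun x : α => R x v).card : ℝ) := by
  simp only [Finset.card_filter, Nat.cast_sum]
  rw [Finset.sum_comm]

/-- **The robust class rung (unconditional).** See the module docstring. [folklore] -/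
theorem shwF_robustClassRung :
    ∃ k₀ : ℕ, ∀ k : ℕ, k₀ ≤ k → ∀ (𝒢 : (n N : ℕ) → ((Fin N → Bool) → Bool) → Prop),
      (∀ τ : ℝ, 0 < τ → ∃ D : ℕ → ℕ,
        (fun n : ℕ => (D n : ℝ)) =o[atTop] (fun n : ℕ => (n : ℝ) / Real.log n ^ 2) ∧
        ∀ᶠ n : ℕ in atTop, ∀ (N : ℕ) (g : (Fin N → Bool) → Bool), 𝒢 n N g →
          tailWeight (fun x => sgn (g x)) (D n) ≤ τ) →
      ∀ ε : ℝ, 0 < ε →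
      ∀ᶠ n : ℕ in atTop, ∀ j m : ℕ, n = 2 ^ j → m = ⌊5 * 2 ^ k * Real.log k / k * n⌋₊ →
        ∀ g : Fin (2 ^ j) → (Fin (m * k * (j + 1)) → Bool) → Bool,
          (∀ v, 𝒢 n (m * k * (j + 1)) (g v)) →
          ((univ.filter fun x : Fin (m * k * (j + 1)) → Bool =>
              ∀ i : Fin m, ∃ j' : Fin k, g (litArrayOfBits m k j x i j').1 x =
                (litArrayOfBits m k j x i j').2).card : ℝ)
            ≤ ε * 2 ^ (m * k * (j + 1)) := by
  obtain ⟨k₀, hk₀⟩ := vanishingLowDegreeRobustSign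
  refine ⟨k₀, fun k hk 𝒢 hclass ε hε => ?_⟩
  obtain ⟨η₀, hη₀, hR⟩ := hk₀ k hk
  -- the tail level `τ = ε η₀ / 18` and its degree sequence
  set τ : ℝ := ε * η₀ / 18 with hτ
  have hτpos : 0 < τ := by positivity
  obtain ⟨D, hDo, htail⟩ := hclass τ hτpos
  have hev := hR 9 (by norm_num) D hDo (ε / 2) (half_pos hε)
  filter_upwards [hev, htail] with n hRn htailn
  intro j m hnj hm g hOK
  subst hnj
  -- the surrogate `P x v = -3 T_{<D n} (sgn ∘ g v) (x)` on the `m k (j+1)` input bits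
  set c : Fin (2 ^ j) → Finset (Fin (m * k * (j + 1))) → ℝ := fun v S =>
    if S.card < D (2 ^ j) then -3 * cubeFourierCoeff (fun y => sgn (g v y)) S else 0 with hc
  have hc0 : ∀ v S, D (2 ^ j) ≤ S.card → c v S = 0 := fun v S hS => by
    simp only [hc]; rw [if_neg (not_lt.2 hS)]
  set P : (Fin (m * k * (j + 1)) → Bool) → Fin (2 ^ j) → ℝ := fun x v =>
    ∑ S, c v S * walsh S x with hP
  -- the low-degree map on literal arrays, read through the inverse encoding
  set F : (Fin m → Fin k → Fin (2 ^ j) × Bool) → Fin (2 ^ j) → ℝ :=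
    fun Φ v => P (bitsOfLitArray m k j Φ) v with hF
  -- (i) coordinate degree
  have hdeg : ∀ v : Fin (2 ^ j), IsCoordDegreeLE (D (2 ^ j))
      (fun y : Fin m × Fin k → Fin (2 ^ j) × Bool => F (Function.curry y) v) := fun v =>
    shwRung_isCoordDegreeLE_walshSum m k j (D (2 ^ j)) (c v) (hc0 v)
  -- (ii) energy `≤ 9 n #Inst`
  have henergy : ∑ Φ : Fin m → Fin k → Fin (2 ^ j) × Bool, ∑ v : Fin (2 ^ j), F Φ v ^ 2
      ≤ 9 * ((2 ^ j : ℕ) : ℝ) * Fintype.card (Fin m → Fin k → Fin (2 ^ j) × Bool) := by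
    have hG : ∑ Φ : Fin m → Fin k → Fin (2 ^ j) × Bool, ∑ v, F Φ v ^ 2 =
        ∑ x : Fin (m * k * (j + 1)) → Bool, ∑ v, P x v ^ 2 := by
      refine Fintype.sum_equiv (litArrayEquiv m k j).symm _ _ fun Φ => ?_
      rfl
    rw [hG, card_litArray_two_pow, Finset.sum_comm]
    calc ∑ v : Fin (2 ^ j), ∑ x : Fin (m * k * (j + 1)) → Bool, P x v ^ 2
        ≤ ∑ _v : Fin (2 ^ j), (9 * 2 ^ (m * k * (j + 1)) : ℝ) := by
          refine Finset.sum_le_sum fun v _ => ?_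
          simp only [hP, hc]
          exact shw_energy (D (2 ^ j)) (g v)
      _ = 9 * ((2 ^ j : ℕ) : ℝ) * ((2 ^ (m * k * (j + 1)) : ℕ) : ℝ) := by
          rw [Finset.sum_const, Finset.card_univ, Fintype.card_fin, nsmul_eq_mul]
          push_cast
          ring
  -- (iii) the sign-robust low-degree bound for `F`
  have hRF := hRn m hm F hdeg henergy
  rw [card_litArray_two_pow] at hRF
  -- (iv) bad (input, coordinate) pairs and the Markov set of inputs with many bad coordinates
  set bad : (Fin (m * k * (j + 1)) → Bool) → Fin (2 ^ j) → Prop := fun x v =>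
    ¬ (1 ≤ |P x v| ∧ decide (0 ≤ P x v) = g v x) with hbad
  have hbadsum : ∑ x : Fin (m * k * (j + 1)) → Bool,
      ((univ.filter fun v : Fin (2 ^ j) => bad x v).card : ℝ) ≤
      9 * τ * ((2 ^ j : ℕ) : ℝ) * 2 ^ (m * k * (j + 1)) := by
    rw [shwF_sum_card_filter_comm]
    calc ∑ v : Fin (2 ^ j),
          ((univ.filter fun x : Fin (m * k * (j + 1)) → Bool => bad x v).card : ℝ)
        ≤ ∑ v : Fin (2 ^ j),
            9 * (2 ^ (m * k * (j + 1)) * tailWeight (fun y => sgn (g v y)) (D (2 ^ j))) := by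
          refine Finset.sum_le_sum fun v _ => ?_
          simp only [hbad, hP, hc]
          exact shw_bad_card_le (D (2 ^ j)) (g v)
      _ ≤ ∑ _v : Fin (2 ^ j), 9 * (2 ^ (m * k * (j + 1)) * τ) := by
          refine Finset.sum_le_sum fun v _ => ?_
          exact mul_le_mul_of_nonneg_left
            (mul_le_mul_of_nonneg_left (htailn (m * k * (j + 1)) (g v) (hOK v)) (by positivity))
            (by norm_num)
      _ = 9 * τ * ((2 ^ j : ℕ) : ℝ) * 2 ^ (m * k * (j + 1)) := by
          rw [Finset.sum_const, Finset.card_univ, Fintype.card_fin, nsmul_eq_mul]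
          push_cast
          ring
  have hnpos : (0 : ℝ) < ((2 ^ j : ℕ) : ℝ) := by positivity
  have hη₀n : 0 < η₀ * ((2 ^ j : ℕ) : ℝ) := by positivity
  have hmarkov := shwF_card_filter_lt_card_le bad (η₀ * ((2 ^ j : ℕ) : ℝ))
  have hBx : ((univ.filter fun x : Fin (m * k * (j + 1)) → Bool =>
      η₀ * ((2 ^ j : ℕ) : ℝ) <
        ((univ.filter fun v : Fin (2 ^ j) => bad x v).card : ℝ)).card : ℝ) ≤
      ε / 2 * 2 ^ (m * k * (j + 1)) := by
    have h1 : η₀ * ((2 ^ j : ℕ) : ℝ) * ((univ.filter fun x : Fin (m * k * (j + 1)) → Bool =>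
        η₀ * ((2 ^ j : ℕ) : ℝ) <
          ((univ.filter fun v : Fin (2 ^ j) => bad x v).card : ℝ)).card : ℝ) ≤
        9 * τ * ((2 ^ j : ℕ) : ℝ) * 2 ^ (m * k * (j + 1)) := hmarkov.trans hbadsum
    have h2 : 9 * τ * ((2 ^ j : ℕ) : ℝ) * 2 ^ (m * k * (j + 1)) =
        η₀ * ((2 ^ j : ℕ) : ℝ) * (ε / 2 * 2 ^ (m * k * (j + 1))) := by
      rw [hτ]; ring
    rw [h2] at h1
    exact le_of_mul_le_mul_left h1 hη₀n
  -- (v) solved inputs with few bad coordinates inject into the robust event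
  have hgood : ((univ.filter fun x : Fin (m * k * (j + 1)) → Bool =>
      (∀ i : Fin m, ∃ j' : Fin k, g (litArrayOfBits m k j x i j').1 x =
        (litArrayOfBits m k j x i j').2) ∧
      ¬ η₀ * ((2 ^ j : ℕ) : ℝ) <
        ((univ.filter fun v : Fin (2 ^ j) => bad x v).card : ℝ)).card : ℝ) ≤
      ε / 2 * ((2 ^ (m * k * (j + 1)) : ℕ) : ℝ) := by
    refine le_trans ?_ hRF
    refine Nat.cast_le.2 (Finset.card_le_card_of_injOn (litArrayOfBits m k j)
      (fun x hx => ?_) (fun x _ y _ hxy => litArrayOfBits_injective hxy))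
    simp only [coe_filter, mem_univ, true_and, Set.mem_setOf_eq] at hx ⊢
    obtain ⟨hsol, hfew⟩ := hx
    rw [not_lt] at hfew
    refine ⟨fun v => g v x, hsol, le_trans ?_ hfew⟩
    have hFx : ∀ v, F (litArrayOfBits m k j x) v = P x v := fun v => by
      simp only [hF, bitsOfLitArray_litArrayOfBits]
    refine Nat.cast_le.2 (Finset.card_le_card fun v hv => ?_)
    simp only [Finset.mem_filter, Finset.mem_univ, true_and, hbad] at hv ⊢
    rw [hFx] at hv
    rintro ⟨h1, h2⟩
    rcases hv with hv | hv
    · exact absurd h1 (not_le.2 hv)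
    · exact hv h2.symm
  -- (vi) conclusion
  have hsplit := shwRung_card_filter_le_and_add_not
    (fun x : Fin (m * k * (j + 1)) → Bool => ∀ i : Fin m, ∃ j' : Fin k,
      g (litArrayOfBits m k j x i j').1 x = (litArrayOfBits m k j x i j').2)
    (fun x => ¬ η₀ * ((2 ^ j : ℕ) : ℝ) <
      ((univ.filter fun v : Fin (2 ^ j) => bad x v).card : ℝ))
  have hsplit' := (Nat.cast_le (α := ℝ)).2 hsplit
  rw [Nat.cast_add] at hsplit'
  have hBx' : ((univ.filter fun x : Fin (m * k * (j + 1)) → Bool =>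
      ¬ ¬ η₀ * ((2 ^ j : ℕ) : ℝ) <
        ((univ.filter fun v : Fin (2 ^ j) => bad x v).card : ℝ)).card : ℝ) ≤
      ε / 2 * 2 ^ (m * k * (j + 1)) := by
    simp only [not_not]
    exact hBx
  have hpow : ((2 ^ (m * k * (j + 1)) : ℕ) : ℝ) = 2 ^ (m * k * (j + 1)) := by push_cast; ring
  rw [hpow] at hgood
  linarith [hsplit', hgood, hBx']

end Summit.PneNP.PneNP.Theorems

end
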